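import Summits.Ventures.PercRepro.RankLevelSetCoreSharp

/-!
# PercRepro — the rank-`q` count with the basis factored out: `#{r = q} ≤ C(n, q) · 2^{2^q − 1 − q}` (night-1, gen 3)

`proofs/NIGHT-1-C025-induction.md` §14.12. `ncard_eRk_eq_le_choose_mul` counted every subset of the closure of a
`q`-set; a rank-`q` set `X` with basis `I` is `I ∪ Z` for `Z ⊆ cl(I) ∖ I`, and `|cl(I) ∖ I| ≤ 2^q − 1 − q` on the
`e`-free core, so the fibre over `I` has at most `2^{2^q − 1 − q}` members:

* **`ncard_eRk_eq_le_choose_mul'`** — `#{X ⊆ E : r(X) = q} ≤ C(n, q) · 2^{2^q − 1 − q}`;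
* **`ncard_eRk_le_le_sum_choose_mul'`** — `#{X ⊆ E : r(X) ≤ q} ≤ (Σ_{j ≤ q} C(n, j)) · 2^{2^q − 1 − q}`;
* **`coreSharper_arith_I`**, **`core_all_corank_of_thresholds''`** — the core theorem of `RankLevelSetCoreLarge` with
  these counts: the corank bound drops from `2q + 2^q` to `q + 2^q`;
* **`c025_core_three_sharper`** (`p ≥ 23`, `|E| ≥ p + 12`), **`c025_core_four_sharper`** (`p ≥ 38`, `|E| ≥ p + 21`),
  **`c025_core_five_sharper`** (`p ≥ 62`, `|E| ≥ p + 38`).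
Axioms: standard.
-/

open scoped Matroid

namespace PercRepro

namespace ThmN

open Set

variable {α : Type}

/-- **The rank-`q` sets of the `e`-free core number at most `C(n, q) · 2^{2^q − 1 − q}`**: every rank-`q` set is
`I ∪ Z` for a basis `I` (a `q`-subset of `E`) and `Z ⊆ cl(I) ∖ I`, and `|cl(I) ∖ I| ≤ 2^q − 1 − q`. -/
theorem ncard_eRk_eq_le_choose_mul' (M : Matroid α) [M.Finite]
    (hfree : ∀ e ∈ M.E, ∃ A ⊆ M.E \ {e}, e ∉ M.closure A ∧ e ∉ M.closure ((M.E \ {e}) \ A)) (q : ℕ) :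
    {X : Set α | X ⊆ M.E ∧ M.eRk X = q}.ncard ≤
      M.ground_finite.toFinset.card.choose q * 2 ^ (2 ^ q - 1 - q) := by
  classical
  have hL := not_isLoop_of_free M hfree
  set Ef := M.ground_finite.toFinset with hEf
  have hE : (Ef : Set α) = M.E := Set.Finite.coe_toFinset _
  set S := {X : Set α | X ⊆ M.E ∧ M.eRk X = q} with hS
  have hclfin : ∀ s : Finset α, (M.closure (s : Set α) \ (s : Set α)).Finite :=
    fun s => (M.ground_finite.subset (M.closure_subset_ground _)).subset Set.sdiff_subset
  set Tf : Finset (Finset α × Set α) := (Ef.powersetCard q).biUnion (fun s =>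
    ((hclfin s).toFinset.powerset.image (fun t : Finset α => (t : Set α))).image
      (fun Z => (s, (s : Set α) ∪ Z))) with hTf
  -- every rank-`q` set `X` is `I ∪ (X ∖ I)` for a basis `I`, with `X ∖ I ⊆ cl(I) ∖ I`
  have hex : ∀ X ∈ S, ∃ s : Finset α, (s, X) ∈ Tf := by
    intro X hX
    obtain ⟨I, hI⟩ := M.exists_isBasis X hX.1
    have hIfin : I.Finite := M.ground_finite.subset (hI.subset.trans hX.1)
    have hIcard : I.ncard = q := by
      have h := hI.encard_eq_eRk
      rw [hX.2, ← hIfin.cast_ncard_eq] at h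
      exact_mod_cast h
    refine ⟨hIfin.toFinset, ?_⟩
    rw [hTf, Finset.mem_biUnion]
    refine ⟨hIfin.toFinset, ?_, ?_⟩
    · rw [Finset.mem_powersetCard]
      refine ⟨?_, ?_⟩
      · intro x hx
        rw [Set.Finite.mem_toFinset] at hx
        rw [hEf, Set.Finite.mem_toFinset]
        exact hX.1 (hI.subset hx)
      · rw [← Set.ncard_eq_toFinset_card I hIfin]; exact hIcard
    · rw [Finset.mem_image]
      refine ⟨X \ I, ?_, ?_⟩
      · apply Matroid.mem_powersetSets
        rw [Set.Finite.coe_toFinset]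
        exact Set.sdiff_subset_sdiff_left hI.subset_closure
      · rw [Set.Finite.coe_toFinset, Set.union_sdiff_cancel hI.subset]
  let g : Set α → Finset α × Set α := fun X =>
    if h : X ∈ S then (Classical.choose (hex X h), X) else (∅, X)
  have hgmaps : ∀ X ∈ S, g X ∈ (Tf : Set (Finset α × Set α)) := by
    intro X hX
    simp only [g, dif_pos hX]
    exact Classical.choose_spec (hex X hX)
  have hginj : Set.InjOn g S := by
    intro X hX Y hY hXY
    simp only [g, dif_pos hX, dif_pos hY, Prod.mk.injEq] at hXY
    exact hXY.2
  have hS : S.ncard ≤ Tf.card := by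
    rw [← Set.ncard_coe_finset]
    exact Set.ncard_le_ncard_of_injOn g hgmaps hginj (Tf.finite_toSet)
  have hTfcard : Tf.card ≤ Ef.card.choose q * 2 ^ (2 ^ q - 1 - q) := by
    calc Tf.card ≤ ∑ s ∈ Ef.powersetCard q,
          (((hclfin s).toFinset.powerset.image (fun t : Finset α => (t : Set α))).image
            (fun Z => (s, (s : Set α) ∪ Z))).card := Finset.card_biUnion_le
      _ ≤ ∑ s ∈ Ef.powersetCard q, 2 ^ (2 ^ q - 1 - q) := by
          apply Finset.sum_le_sum
          intro s hs
          rw [Finset.mem_powersetCard] at hs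
          calc (((hclfin s).toFinset.powerset.image (fun t : Finset α => (t : Set α))).image
                (fun Z => (s, (s : Set α) ∪ Z))).card
              ≤ ((hclfin s).toFinset.powerset.image (fun t : Finset α => (t : Set α))).card :=
                Finset.card_image_le
            _ ≤ 2 ^ (M.closure (s : Set α) \ (s : Set α)).ncard := Matroid.card_powersetSets_le (hclfin s)
            _ ≤ 2 ^ (2 ^ q - 1 - q) := by
                apply Nat.pow_le_pow_right (by norm_num)
                have hsE : (s : Set α) ⊆ M.E := by rw [← hE]; exact Finset.coe_subset.2 hs.1
                have hr : M.eRk (M.closure (s : Set α)) ≤ q := by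
                  rw [M.eRk_closure_eq]
                  calc M.eRk (s : Set α) ≤ (s : Set α).encard := M.eRk_le_encard _
                    _ = q := by rw [Set.encard_coe_eq_coe_finsetCard, hs.2]
                have hcl := ncard_add_one_le_two_pow_of_eRk_le M hL hfree q (M.closure (s : Set α))
                  (M.closure_subset_ground _) hr
                have hsub : (s : Set α) ⊆ M.closure (s : Set α) := M.subset_closure _ hsE
                have hclfin' : (M.closure (s : Set α)).Finite := M.ground_finite.subset (M.closure_subset_ground _)
                have hdiff : (M.closure (s : Set α) \ (s : Set α)).ncard + (s : Set α).ncard =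
                    (M.closure (s : Set α)).ncard := Set.ncard_sdiff_add_ncard_of_subset hsub hclfin'
                have hsc : (s : Set α).ncard = q := by rw [Set.ncard_coe_finset, hs.2]
                omega
      _ = Ef.card.choose q * 2 ^ (2 ^ q - 1 - q) := by
          rw [Finset.sum_const, smul_eq_mul, Finset.card_powersetCard]
  exact hS.trans hTfcard

/-- **The sets of rank `≤ q` of the `e`-free core number at most `(Σ_{j ≤ q} C(n, j)) · 2^{2^q − 1 − q}`**. -/
theorem ncard_eRk_le_le_sum_choose_mul' (M : Matroid α) [M.Finite]
    (hfree : ∀ e ∈ M.E, ∃ A ⊆ M.E \ {e}, e ∉ M.closure A ∧ e ∉ M.closure ((M.E \ {e}) \ A)) (q : ℕ) :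
    {X : Set α | X ⊆ M.E ∧ M.eRk X ≤ q}.ncard ≤
      (∑ j ∈ Finset.range (q + 1), M.ground_finite.toFinset.card.choose j) * 2 ^ (2 ^ q - 1 - q) := by
  have hfin : ∀ P : Set α → Prop, {X : Set α | X ⊆ M.E ∧ P X}.Finite :=
    fun P => M.ground_finite.finite_subsets.subset (fun X hX => hX.1)
  induction q with
  | zero =>
    rw [Finset.sum_range_one]
    have hsub : {X : Set α | X ⊆ M.E ∧ M.eRk X ≤ ((0 : ℕ) : ℕ∞)} ⊆
        {X : Set α | X ⊆ M.E ∧ M.eRk X = ((0 : ℕ) : ℕ∞)} := by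
      intro X hX
      exact ⟨hX.1, by simpa using hX.2⟩
    calc {X : Set α | X ⊆ M.E ∧ M.eRk X ≤ ((0 : ℕ) : ℕ∞)}.ncard
        ≤ {X : Set α | X ⊆ M.E ∧ M.eRk X = ((0 : ℕ) : ℕ∞)}.ncard := Set.ncard_le_ncard hsub (hfin _)
      _ ≤ _ := ncard_eRk_eq_le_choose_mul' M hfree 0
  | succ q ih =>
    rw [Finset.sum_range_succ, add_mul]
    have hsplit : {X : Set α | X ⊆ M.E ∧ M.eRk X ≤ ((q + 1 : ℕ) : ℕ∞)} ⊆
        {X : Set α | X ⊆ M.E ∧ M.eRk X ≤ (q : ℕ∞)} ∪ {X : Set α | X ⊆ M.E ∧ M.eRk X = ((q + 1 : ℕ) : ℕ∞)} := by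
      intro X hX
      rcases le_or_gt (M.eRk X) q with h | h
      · exact Or.inl ⟨hX.1, h⟩
      · refine Or.inr ⟨hX.1, le_antisymm hX.2 ?_⟩
        rw [Nat.cast_succ]
        exact Order.add_one_le_of_lt h
    have hmono : 2 ^ (2 ^ q - 1 - q) ≤ 2 ^ (2 ^ (q + 1) - 1 - (q + 1)) :=
      Nat.pow_le_pow_right (by norm_num) (by have := Nat.one_le_two_pow (n := q); rw [pow_succ]; omega)
    calc {X : Set α | X ⊆ M.E ∧ M.eRk X ≤ ((q + 1 : ℕ) : ℕ∞)}.ncard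
        ≤ ({X : Set α | X ⊆ M.E ∧ M.eRk X ≤ (q : ℕ∞)} ∪
            {X : Set α | X ⊆ M.E ∧ M.eRk X = ((q + 1 : ℕ) : ℕ∞)}).ncard :=
          Set.ncard_le_ncard hsplit ((hfin _).union (hfin _))
      _ ≤ {X : Set α | X ⊆ M.E ∧ M.eRk X ≤ (q : ℕ∞)}.ncard +
            {X : Set α | X ⊆ M.E ∧ M.eRk X = ((q + 1 : ℕ) : ℕ∞)}.ncard := Set.ncard_union_le _ _
      _ ≤ (∑ j ∈ Finset.range (q + 1), M.ground_finite.toFinset.card.choose j) * 2 ^ (2 ^ q - 1 - q) +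
            M.ground_finite.toFinset.card.choose (q + 1) * 2 ^ (2 ^ (q + 1) - 1 - (q + 1)) :=
          add_le_add ih (ncard_eRk_eq_le_choose_mul' M hfree (q + 1))
      _ ≤ (∑ j ∈ Finset.range (q + 1), M.ground_finite.toFinset.card.choose j) * 2 ^ (2 ^ (q + 1) - 1 - (q + 1)) +
            M.ground_finite.toFinset.card.choose (q + 1) * 2 ^ (2 ^ (q + 1) - 1 - (q + 1)) := by gcongr

/-- **Regime I arithmetic with a general constant `2^k`** (`n ≤ 2p − 1`, `n ≥ p + 2q + k + 2`). -/
theorem coreSharper_arith_I {n p q k : ℕ} {Φ U Y A B : ℚ} (hq : 2 ≤ q)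
    (hn : p + 2 * q + k + 2 ≤ n)
    (hΦ : Φ ≤ (2 ^ (p + q) : ℚ) / ((p + q).choose p : ℚ)) (hU0 : 0 ≤ U)
    (hU : U ≤ (n.choose q : ℚ) * 2 ^ k)
    (hCn : (n.choose q : ℚ) ≤ 2 ^ q * ((p + q).choose p : ℚ))
    (hY : (2 : ℚ) ^ n ≤ Y + A + B) (hA : A ≤ 2 ^ (n - 3)) (hB : B ≤ 2 ^ (n - 1)) : Φ * U ≤ Y := by
  have hc : (0 : ℚ) < ((p + q).choose p : ℚ) := by exact_mod_cast Nat.choose_pos (Nat.le_add_right p q)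
  have h1 : Φ * U ≤ (2 ^ (p + q) : ℚ) / ((p + q).choose p : ℚ) * ((n.choose q : ℚ) * 2 ^ k) :=
    mul_le_mul hΦ hU hU0 (by positivity)
  have h2 : (2 ^ (p + q) : ℚ) / ((p + q).choose p : ℚ) * ((n.choose q : ℚ) * 2 ^ k) ≤
      2 ^ (p + q) * 2 ^ q * 2 ^ k := by
    rw [div_mul_eq_mul_div, div_le_iff₀ hc]
    calc (2 ^ (p + q) : ℚ) * ((n.choose q : ℚ) * 2 ^ k)
        ≤ 2 ^ (p + q) * ((2 ^ q * ((p + q).choose p : ℚ)) * 2 ^ k) := by gcongr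
      _ = 2 ^ (p + q) * 2 ^ q * 2 ^ k * ((p + q).choose p : ℚ) := by ring
  have h3 : (2 : ℚ) ^ (p + q) * 2 ^ q * 2 ^ k ≤ 2 ^ (n - 2) := by
    rw [← pow_add, ← pow_add]
    exact pow_le_pow_right₀ (by norm_num) (by omega)
  have e3 : (2 : ℚ) ^ n = 2 ^ (n - 3) * 8 := by
    rw [show (8 : ℚ) = 2 ^ 3 by norm_num, ← pow_add]; congr 1; omega
  have e2 : (2 : ℚ) ^ (n - 2) = 2 ^ (n - 3) * 2 := by
    rw [← pow_succ]; congr 1; omega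
  have e1 : (2 : ℚ) ^ (n - 1) = 2 ^ (n - 3) * 4 := by
    rw [show (4 : ℚ) = 2 ^ 2 by norm_num, ← pow_add]; congr 1; omega
  have hΦU : Φ * U ≤ 2 ^ (n - 3) * 2 := by rw [← e2]; exact h1.trans (h2.trans h3)
  have hX : (0 : ℚ) ≤ 2 ^ (n - 3) := by positivity
  rw [e3] at hY
  rw [e1] at hB
  linarith

/-- **THEOREM C∞, THE CORE, WITH THE BASIS FACTORED OUT**: with `K = 2^{2^q − 1 − q}`, thresholds `N₁` (regime I:
`8(q+1)·K·n^q ≤ 2^n` for `n ≥ N₁`) and `P₂` (regime II: `2^{p+q}·K·(2a + 1) ≤ 4^a`, `a = p − 1 − q`, for `p ≥ P₂`),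
every finite matroid of rank `p ≥ max N₁ P₂ (2^q + 2)` with an `e`-free partition for every element and
`|E| > p + q + 2^q` satisfies `Φ(p, q)·#U(p, q) ≤ #Y(p, q)`. -/
theorem core_all_corank_of_thresholds'' (q : ℕ) (hq : 2 ≤ q) (N₁ P₂ : ℕ)
    (hN₁ : ∀ n, N₁ ≤ n → 8 * (q + 1) * 2 ^ (2 ^ q - 1 - q) * n ^ q ≤ 2 ^ n)
    (hP₂ : ∀ p, P₂ ≤ p → 2 ^ (p + q) * 2 ^ (2 ^ q - 1 - q) * (2 * (p - 1 - q) + 1) ≤ 4 ^ (p - 1 - q)) :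
    ∀ {α : Type} (M : Matroid α) [M.Finite] (p : ℕ), max (max N₁ P₂) (2 ^ q + 2) ≤ p → M.eRank = (p : ℕ∞) →
      p + (q + 2 ^ q) < M.E.ncard →
      (∀ e ∈ M.E, ∃ A ⊆ M.E \ {e}, e ∉ M.closure A ∧ e ∉ M.closure ((M.E \ {e}) \ A)) → RLS M p q := by
  classical
  intro α M _ p hP hR hbig hfree
  set n := M.E.ncard with hn_def
  have hEcard : M.ground_finite.toFinset.card = n := by
    rw [hn_def, Set.ncard_eq_toFinset_card _ M.ground_finite]
  have hq2 : 2 * q ≤ 2 ^ q := by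
    have : q ≤ 2 ^ (q - 1) := by
      calc q = (q - 1) + 1 := by omega
        _ ≤ 2 ^ (q - 1) := Nat.lt_two_pow_self
    calc 2 * q ≤ 2 * 2 ^ (q - 1) := by omega
      _ = 2 ^ (q - 1 + 1) := by ring
      _ = 2 ^ q := by congr 1; omega
  have hpP : 2 ^ q + 2 ≤ p := le_trans (le_max_right _ _) hP
  have hN₁p : N₁ ≤ p := le_trans (le_max_left _ _) (le_trans (le_max_left _ _) hP)
  have hP₂p : P₂ ≤ p := le_trans (le_max_right _ _) (le_trans (le_max_left _ _) hP)
  have hpn : p ≤ n := by omega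
  have hU : Matroid.topCount M p q ≤ n.choose q * 2 ^ (2 ^ q - 1 - q) := by
    calc Matroid.topCount M p q ≤ Matroid.levelCount M q := Matroid.topCount_le_levelCount_bot p q
      _ = {X : Set α | X ⊆ M.E ∧ M.eRk X = q}.ncard := rfl
      _ ≤ n.choose q * 2 ^ (2 ^ q - 1 - q) := by rw [← hEcard]; exact ncard_eRk_eq_le_choose_mul' M hfree q
  have hΦ := phiK_le_two_pow_div p q
  have hU0 : (0 : ℚ) ≤ (Matroid.topCount M p q : ℚ) := by positivity
  have hUq : (Matroid.topCount M p q : ℚ) ≤ (n.choose q : ℚ) * 2 ^ (2 ^ q - 1 - q) := by exact_mod_cast hU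
  rw [RLS_iff]
  rcases Nat.lt_or_ge n (2 * p) with hsmall | hlarge
  · have hd : M.E.encard = M.eRank + ((n - p : ℕ) : ℕ∞) := by
      rw [hR, ← M.ground_finite.cast_ncard_eq]
      norm_cast
      omega
    have hY := Matroid.two_pow_le_midCount_add (M := M) p q hR
    have hA := ncard_eRk_le_le_sum_choose_mul' M hfree q
    have hB := Matroid.ncard_spanning_le (M := M) hd
    rw [hEcard] at hY hA hB
    have hA' : (∑ j ∈ Finset.range (q + 1), n.choose j) * 2 ^ (2 ^ q - 1 - q) ≤ 2 ^ (n - 3) := by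
      have h1 := sum_choose_le_mul_pow n q (by omega)
      have h2 := hN₁ n (by omega)
      have h3 : 2 ^ n = 2 ^ (n - 3) * 8 := by
        rw [show (8 : ℕ) = 2 ^ 3 by norm_num, ← pow_add]; congr 1; omega
      have h5 : 8 * ((∑ j ∈ Finset.range (q + 1), n.choose j) * 2 ^ (2 ^ q - 1 - q)) ≤ 8 * 2 ^ (n - 3) := by
        calc 8 * ((∑ j ∈ Finset.range (q + 1), n.choose j) * 2 ^ (2 ^ q - 1 - q))
            ≤ 8 * (((q + 1) * n ^ q) * 2 ^ (2 ^ q - 1 - q)) := by gcongr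
          _ = 8 * (q + 1) * 2 ^ (2 ^ q - 1 - q) * n ^ q := by ring
          _ ≤ 2 ^ n := h2
          _ = 8 * 2 ^ (n - 3) := by rw [h3]; ring
      exact Nat.le_of_mul_le_mul_left h5 (by norm_num)
    have hB' : ∑ j ∈ Finset.range (n - p + 1), n.choose j ≤ 2 ^ (n - 1) :=
      sum_choose_le_two_pow_pred n (n - p) (by omega)
    have hCn : n.choose q ≤ 2 ^ q * (p + q).choose p := by
      rw [Nat.choose_symm_add]
      exact choose_le_two_pow_mul_choose n p q (by omega)
    have hYq : (2 : ℚ) ^ n ≤ (Matroid.midCount M p q : ℚ) + ({X : Set α | X ⊆ M.E ∧ M.eRk X ≤ q}.ncard : ℚ) +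
        ({X : Set α | X ⊆ M.E ∧ M.eRk X = M.eRank}.ncard : ℚ) := by exact_mod_cast hY
    have hAq : ({X : Set α | X ⊆ M.E ∧ M.eRk X ≤ q}.ncard : ℚ) ≤ 2 ^ (n - 3) := by
      exact_mod_cast hA.trans hA'
    have hBq : ({X : Set α | X ⊆ M.E ∧ M.eRk X = M.eRank}.ncard : ℚ) ≤ 2 ^ (n - 1) := by
      exact_mod_cast hB.trans hB'
    have hCnq : (n.choose q : ℚ) ≤ 2 ^ q * ((p + q).choose p : ℚ) := by exact_mod_cast hCn
    have hk : p + 2 * q + (2 ^ q - 1 - q) + 2 ≤ n := by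
      have := Nat.one_le_two_pow (n := q); omega
    exact coreSharper_arith_I hq hk hΦ hU0 hUq hCnq hYq hAq hBq
  · have hY := choose_le_midCount_of_two_pow_le M hfree (p := p) (q := q) (by omega) (by omega)
    rw [hEcard] at hY
    have hkey := choose_mul_le_choose_mul_of_threshold n p q (2 ^ (2 ^ q - 1 - q)) (by omega) hlarge (hP₂ p hP₂p)
    have hYq : (n.choose (p - 1) : ℚ) ≤ (Matroid.midCount M p q : ℚ) := by exact_mod_cast hY
    have hUq' : (Matroid.topCount M p q : ℚ) ≤ (n.choose q : ℚ) * ((2 ^ (2 ^ q - 1 - q) : ℕ) : ℚ) := by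
      exact_mod_cast hU
    exact coreSharp_arith_II hΦ hU0 hUq' hkey hYq

/-- **The core at `q = 3`, sharper**: rank `p ≥ 23`, `e`-free partitions, `|E| ≥ p + 12` ⇒ C-025 at `(p, 3)`. -/
theorem c025_core_three_sharper (M : Matroid α) [M.Finite] (p : ℕ) (hp : 23 ≤ p) (hR : M.eRank = (p : ℕ∞))
    (hbig : p + 11 < M.E.ncard)
    (hfree : ∀ e ∈ M.E, ∃ A ⊆ M.E \ {e}, e ∉ M.closure A ∧ e ∉ M.closure ((M.E \ {e}) \ A)) : RLS M p 3 := by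
  have hN₁ : ∀ n, 23 ≤ n → 8 * (3 + 1) * 2 ^ (2 ^ 3 - 1 - 3) * n ^ 3 ≤ 2 ^ n :=
    mul_pow_le_two_pow_of_base (8 * (3 + 1) * 2 ^ (2 ^ 3 - 1 - 3)) 3 23 (by norm_num) (by norm_num) (by norm_num)
  have hP₂ := threshold_II_of_base 3 (2 ^ (2 ^ 3 - 1 - 3)) 21 (by norm_num) (by norm_num)
  have hmax : max (max 23 21) (2 ^ 3 + 2) = 23 := by decide
  refine core_all_corank_of_thresholds'' 3 (by norm_num) 23 21 hN₁ hP₂ M p (by rw [hmax]; exact hp) hR ?_ hfree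
  norm_num
  exact hbig

/-- **The core at `q = 4`, sharper**: rank `p ≥ 38`, `e`-free partitions, `|E| ≥ p + 21` ⇒ C-025 at `(p, 4)`. -/
theorem c025_core_four_sharper (M : Matroid α) [M.Finite] (p : ℕ) (hp : 38 ≤ p) (hR : M.eRank = (p : ℕ∞))
    (hbig : p + 20 < M.E.ncard)
    (hfree : ∀ e ∈ M.E, ∃ A ⊆ M.E \ {e}, e ∉ M.closure A ∧ e ∉ M.closure ((M.E \ {e}) \ A)) : RLS M p 4 := by
  have hN₁ : ∀ n, 38 ≤ n → 8 * (4 + 1) * 2 ^ (2 ^ 4 - 1 - 4) * n ^ 4 ≤ 2 ^ n :=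
    mul_pow_le_two_pow_of_base (8 * (4 + 1) * 2 ^ (2 ^ 4 - 1 - 4)) 4 38 (by norm_num) (by norm_num) (by norm_num)
  have hP₂ := threshold_II_of_base 4 (2 ^ (2 ^ 4 - 1 - 4)) 35 (by norm_num) (by norm_num)
  have hmax : max (max 38 35) (2 ^ 4 + 2) = 38 := by decide
  refine core_all_corank_of_thresholds'' 4 (by norm_num) 38 35 hN₁ hP₂ M p (by rw [hmax]; exact hp) hR ?_ hfree
  norm_num
  exact hbig

/-- **The core at `q = 5`, sharper**: rank `p ≥ 62`, `e`-free partitions, `|E| ≥ p + 38` ⇒ C-025 at `(p, 5)`. -/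
theorem c025_core_five_sharper (M : Matroid α) [M.Finite] (p : ℕ) (hp : 62 ≤ p) (hR : M.eRank = (p : ℕ∞))
    (hbig : p + 37 < M.E.ncard)
    (hfree : ∀ e ∈ M.E, ∃ A ⊆ M.E \ {e}, e ∉ M.closure A ∧ e ∉ M.closure ((M.E \ {e}) \ A)) : RLS M p 5 := by
  have hN₁ : ∀ n, 62 ≤ n → 8 * (5 + 1) * 2 ^ (2 ^ 5 - 1 - 5) * n ^ 5 ≤ 2 ^ n :=
    mul_pow_le_two_pow_of_base (8 * (5 + 1) * 2 ^ (2 ^ 5 - 1 - 5)) 5 62 (by norm_num) (by norm_num) (by norm_num)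
  have hP₂ := threshold_II_of_base 5 (2 ^ (2 ^ 5 - 1 - 5)) 50 (by norm_num) (by norm_num)
  have hmax : max (max 62 50) (2 ^ 5 + 2) = 62 := by decide
  refine core_all_corank_of_thresholds'' 5 (by norm_num) 62 50 hN₁ hP₂ M p (by rw [hmax]; exact hp) hR ?_ hfree
  norm_num
  exact hbig

end ThmN

end PercRepro
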